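import Summits.QuantumFields.YangMills.Theorems.BalabanUVNodesN11BgRowGaugeRAtWitnessOfPowM
import Literature.MathematicalPhysics.QuantumFieldTheory.Balaban1983to89.Node00.Record12BgRowCoClassGaugeRGuarded

/-!
# DAG node N11 × K1 — «BG-ONEBLOCK» UNDER THE V20-G LETTERS: ROW P11 `bg` ON THE GUARD-GENERIC GAUGE ROAD WITHOUT THE RUN GUARD, the body reading the torus only
# through K0b's (1.12)-cube inclusion `hcubeΩ` (discharged at K1's witness), the prefix guard `Adm` threaded as dag-n07-e's module 54 threads it — and, at the plan's
# V20-G guard `c ≤ ν.M₁ ∧ k + c₀ ≤ F.m + K`, GUARD-FREE AGAIN on every window run of θ₁₅ᶜᶜᴹᵂ(j; γ) from `c ≤ L^j`, `c₀ ≤ F.m` alone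

HEADER — WORK-UNIT METADATA.  Cell `pub-ymgap`, YM-PLAN Track A (HUMAN RULING D-0062 ∕ D-0149 ∕ D-0154 width seats), seat `pub-ymgap-dag-n11-w5` (g3; WIDTH SEAT 5 on NODE n11
[B14]; R455 (A) self-located CLAIM-1 in this seat's own lineage p623895 → p626404, on dag-n07-e g21's LANDED-54 word «G editions of your `_of_hcubeΩ` road … key on 54 by name»,
cell INBOX l.37861 ∕ l.37975), route `BalabanUVNodes` rev 29, item K1⁹ `StabilityBRunRowsAtRecordR13SepCoPHV` = stmt-QuantumFields-27364 (dag-lead KEY MAP v2; helper lane,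
`--kind proof --supports 27364 --as helper`, count-neutral).  [III] = [Balaban1988Convergent], [I] = [Balaban1987RG1], [15] = [Balaban1985Variational], [6] =
[Balaban1985RegularSpaces].  Over this seat's p623895 `…N11BgRowGaugeROfHcubeOmega` (§1 `bgRowAtDatumU_of_classBoundsPos_of_localGauge_of_hcubeΩ` — row P11's analytic body
reading the torus ONLY through `hcubeΩ`) and p626404 `…N11BgRowGaugeRAtWitnessOfPowM` (§1 `hcube_theta13OfThm1CCMW_of_window` = dag-n11-w4 g4's `hcubeΩ_of_powM` ∘ A2ʷ (C1)),
dag-n07-e g21's module 54 `Node00/Record12BgRowCoClassGaugeRGuarded` (p632171: the guard-generic ports `VariationalThm1GaugeRegSepTop7MG ∕ …CoP7MG … M Adm …` of dag-n21-c's R gauge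
sentence, `localGaugeOn_of_thm1GaugeRegSepTop7MG`) and module 49 `Node00/Record12BgRowCoClassCPMFloor` §4 (`VariationalThm1RegSepTop7MG ∕ …CoP7MG … Adm …`,
`plaqSmallOn_of_thm1RegSepTop7MG`).

WHY THIS FILE.  p623895 ∕ p626404 give ROW P11 `bg` at K1's witness θ₁₅ᶜᶜᴹᵂ(j; γ) on EVERY window run, with NO run guard `PartCompat₁₃` (refuted as an ∀-window-run sentence,
dag-n11-w4 p615408) — the producer the N11 node-face consumers read (dag-n11-w1's `…OfBgFact(s)` binders `hbgs : ∀ window run, …`) — from the R letters (8) `VariationalThm1RegSepCoP7M`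
and (9) `VariationalThm1GaugeRegSepCoP7MR … (L^j) c`.  Under plan g86's WORD «V20 = G» the K0 stubs hand the GUARDED letters instead: (8)-G `VariationalThm1RegSepCoP7MG F N Adm …` and
(9)-G `VariationalThm1GaugeRegSepCoP7MG F N M Adm …` at the plan's guard `Adm := fun ν _ _ K k _ => c ≤ ν.M₁ ∧ k + c₀ ≤ F.m + K` — WEAKER hypotheses ((8)∕(9) only at prefixes passing
the guard), so the R road does not fire from them.  This file is the G twin: module 54's `hc ↦ hadm` threading applied to the `hcubeΩ` road (54 §3 ∕ §5 themselves keep (C1)∕(C2) and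
the `PartCompat₁₃` antecedent; dag-n07-e I.36839 ∕ I.37861: «a G edition of the `_of_hcubeΩ` road is n11-w5's, keyed on 54 by name»).
LOCATED ARITHMETIC (why «BG-ONEBLOCK» survives the letter switch).  At a window prefix `(p, n ≤ p.K, s)` of θ₁₅ᶜᶜᴹᵂ(j) the FLOOR half of the plan's guard is `c ≤ L^j = ν.M₁`
(`theta13OfThm1CCMW_M₁`) and the LEVEL half `n + c₀ ≤ F.m + p.K` follows from `n ≤ p.K` alone once `c₀ ≤ F.m` — which the K0 side's located binder `c₀ ≤ j + 1` (k0-s1-w3 g7,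
INBOX l.37256) gives on every non-wrapping family `j + 1 ≤ F.m` (this road's own `hjm`).  So the guard is met at EVERY window run, not only at the `PartCompat₁₃` runs (where the
torus gives `n + j + 1 ≤ F.m + p.K` and nothing more), and §6's conclusions are guard-free: the TYPES of p626404 §2 ∕ §3 with G letters.

WHAT THIS FILE PROVES (8 theorems, 0 `def`, 0 `sorry`; statements = p623895 §2–§4 ∕ p626404 §2–§3 with the letters switched R ↦ G; proofs = the same terms re-keyed on 49 §4 ∕ 54 §2).
§1 ★★ `bgRowAtDatumU_of_thm1RegSepTop7MG_of_thm1GaugeG_of_hcubeΩ` — 54 §2's ★★★ with (C1)∕(C2) replaced by `hcube` (their one use), `hM` dropped; closing term p623895 §1.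
§2 ★★ `bgRowAtDatumCoP_of_thm1RegSepCoP7MG_of_thm1GaugeG_of_hcubeΩ` — 54 §3's ★★★ twin at def-R's `UbgMSCoPOfRecord … s 𝐖` (off the solvable set the junk `1`, `bgRowAtDatum_one`).
§3 ★★ `stage13_bgAtDatumCoP_of_thm1RegSepCoP7MG_of_thm1GaugeG_of_hcubeΩ` — 54 §5's twin: the Stage-13 lift with the guard as an INNER antecedent right after `0 < θ.ν.M₁`, `hcube`
run-indexed as a hypothesis, and NO `PartCompat₁₃` antecedent.
§4 ★★★ `bgSepCoPAt_theta13OfThm1CCMW_of_thm1GaugeG_of_hadm_of_hcomp_of_hjm` · §5 ★★★ `bgProvisoΛ_theta13OfThm1CCMW_of_thm1GaugeG_of_hadm_of_hcomp_of_hjm` — at K1's witness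
θ₁₅ᶜᶜᴹᵂ(j; γ), `j + 1 ≤ F.m`, for ANY guard `Adm` met on the window prefixes (`hadm`): the (7)-guarded separated row-P11 body on every window run and row P11 in its own currency
`BgProvisoΛ … (suppOfRecord₁₃SepCoP …) (UbgOfRecord₁₃CoP …)`; `hcube` DISCHARGED by p626404 §1.
§6 ★★★ `bgSepCoPAt_theta13OfThm1CCMW_of_thm1GaugeLevelFloorG_of_hcomp_of_hjm` · ★★★ `bgProvisoΛ_theta13OfThm1CCMW_of_thm1GaugeLevelFloorG_of_hcomp_of_hjm` (plan's V20-G guard,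
`hc : c ≤ F.L ^ j`, `hc₀ : c₀ ≤ F.m` — GUARD-FREE conclusions) · ★★★ `bgProvisoΛ_theta13OfThm1CCMW_of_thm1GaugeLevelFloorG_of_le_succ_of_hcomp_of_hjm` (the same keyed on the K0 side's
binder `hc₀ : c₀ ≤ j + 1`).

HONEST FRAMING.  Helper lane of K1⁹; count-neutral HYPOTHESIS THREADING around named facts (`Prop`s with parameters, NEVER asserted): (8)-G, (9)-G, (hcomp) ∧ (hcompRev), the
window `0 < γ ≤ ½`, the six signs and `hjm : j + 1 ≤ F.m` are DISPLAYED, inhabited nowhere here; the plan's guard is a CANDIDATE text (K0⁷'s skeleton of record is V19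
87879403b3a26109; V20-G is UNREGISTERED at the time of writing) — if the plan rules another guard, §4∕§5 serve it through `hadm`.  Nothing of Bałaban asserted or discharged;
`Provisos₁₃SepCoPH.bg`'s type untouched; NOT a discharge of row P11; N11 ∕ N07 NOT discharged; K0⁷ ∕ K1⁹ NOT closed, no registered stub touched; counts unmoved (typed 28∕28 ·
discharged 5∕27 · A 5∕28); no summit statement is proved by this seat.  R4 closes only the conditional finite-𝕋⁴ rung `BalabanLadder.UV` of one programme at fixed `ε = L^{−K}`
— NOT ℝ⁴, NOT OS, NOT a mass gap, NOT Clay.  No `sorry`, `axiom`, `def`, `instance`, `notation`.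
Sources (SHAPE ∕ bookkeeping only): [III] (2.1) p.254, (2.4)–(2.8) pp.255–256, (2.12)–(2.13) p.256, (2.18) p.257, (2.27)–(2.28) p.259, (2.34)–(2.41) p.261, Thm 1 p.262, p.257;
[I] (0.1) p.251, Thm 1 p.259, (1.11)–(1.16) p.262; [15] (6)–(7) p.278, Thm 1 (8)–(9) p.279, (144)–(152) pp.300–301, Prop. 8 p.304, p.304 lines 1–2; [6] (1.3)–(1.9) p.77.
-/

noncomputable section

open MeasureTheory
open scoped Matrix.Norms.L2Operator

namespace Summit.QuantumFields.YangMills.Theorems.BalabanUVNodesN11BgRowGaugeGOfHcubeOmega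

open Literature.MathematicalPhysics.QuantumFieldTheory.Balaban1983to89 Node00
open T4Continuum B14.Eq218Concrete B15DeterminingSets FlowStep FlowStepRuns B12RegularSpaces111 B14RegularSpaces234 B14Radii T4AxialGaugeSmallField
open BalabanUVNodesN11BgRowGaugeROfHcubeOmega (bgRowAtDatumU_of_classBoundsPos_of_localGauge_of_hcubeΩ)
open BalabanUVNodesN11BgRowGaugeRAtWitnessOfPowM (hcube_theta13OfThm1CCMW_of_window)

variable {F : T4Family} {N : ℕ} [NeZero N]

/-! ## §1–§2  The row body keyed on the GUARDED (8)- and (9)-sentences, `hcubeΩ` as a hypothesis (54 §2 ∕ §3 with (C1)∕(C2) ↦ `hcube`) -/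

section RowBodyG

/-- **§1 ★★ ROW P11's BODY FOR EVERY MINIMISER `U₀` OVER THE TOP-DOMAIN CLASS (6) AT A PREFIX PASSING THE GUARD (`hadm : Adm ν M g K k s`), FROM THE GUARDED (8)-SENTENCE
`VariationalThm1RegSepTop7MG … Adm …` (49 §4) AND THE GUARDED GAUGE SENTENCE `VariationalThm1GaugeRegSepTop7MG … M Adm …` (54 §1) — `hcubeΩ` AS A HYPOTHESIS**: dag-n07-e's
54 §2 ★★★ `bgRowAtDatumU_of_thm1RegSepTop7MG_of_thm1GaugeG` with the letters (C1)∕(C2) REPLACED by their one use, K0b's (1.12)-cube inclusion `hcube` («every `L^{j+1}M`-cube of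
record meeting a domain `X ⊆ Λ_j(s)` lies in `Ω_j(s)`»), and `hM : 0 < M` DROPPED; equivalently p623895 §2 with `hc : c ≤ ν.M₁ ↦ hadm` and R ↦ G letters.  Proof: 49's
`plaqSmallOn_of_thm1RegSepTop7MG` + 54's `localGaugeOn_of_thm1GaugeRegSepTop7MG` into p623895 §1.  A REDUCTION — the two sentences are hypotheses, never asserted.
[cite: Balaban1985Variational, Thm 1 (2),(6)–(9) pp.278–279, p.304 lines 1–2; Balaban1985RegularSpaces, (1.3)–(1.9) p.77; Balaban1988Convergent, (2.4)–(2.8) pp.255–256, (2.12)–(2.13) p.256, (2.27)–(2.28) p.259, (2.34)–(2.41) p.261; Balaban1987RG1, (0.1) p.251, (1.11)–(1.16) p.262] -/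
theorem bgRowAtDatumU_of_thm1RegSepTop7MG_of_thm1GaugeG_of_hcubeΩ {Sup : (ν : Stage7Numerics) → (K : ℕ) → (ℕ → Set (Site (F.P K) 0)) → Set (Site (F.P K) 0)} {M : ℕ} {Adm : StepGuard F}
    {B₃ B₃' a₀ a₁ : ℝ} (h15 : VariationalThm1RegSepTop7MG F N Sup Adm B₃ a₀ a₁) (h15G : VariationalThm1GaugeRegSepTop7MG F N Sup M Adm B₃ B₃' a₀ a₁)
    (S : Sect2.Setting (MatA N) (SU N)) (hι : S.ι = ιSU N) (h𝓜 : S.𝓜 = B12RegularSpaces111SpecialUnitary.suModel N) (hS : S.Laws) (hpos : S.Pos)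
    (ν : Stage7Numerics) (K k : ℕ) (cR : ℝ)
    (hnum : ∀ n, n ≤ k → 0 < cR * epsOfRecord ν S.flow.g n ∧ cR * epsOfRecord ν S.flow.g n ≤ a₁ ∧ B₃ * (cR * epsOfRecord ν S.flow.g n) ≤ ν.εreg)
    (ha₀ : ν.εreg ≤ a₀) (hcomp : ∀ n, n < k → cR * epsOfRecord ν S.flow.g n ≤ 2 * (cR * epsOfRecord ν S.flow.g (n + 1)))
    (hcomp' : ∀ n, n < k → cR * epsOfRecord ν S.flow.g (n + 1) ≤ 2 * (cR * epsOfRecord ν S.flow.g n))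
    (hα : ∀ n, 1 ≤ n → n ≤ k → 0 < S.lf.alpha0 (S.flow.g n) ∧ 0 < S.lf.alpha1 (S.flow.g n))
    (hBα : ∀ n, 1 ≤ n → n ≤ k → B₃ * (cR * epsOfRecord ν S.flow.g n) ≤ (1 - S.βc) * S.lf.alpha0 (S.flow.g n))
    (htI : ∀ n, 1 ≤ n → n ≤ k → B₃' * (cR * epsOfRecord ν S.flow.g n) ≤ S.cB * S.lf.alpha0 (S.flow.g n))
    (htMS : ∀ n, 1 ≤ n → n ≤ k → B₃' * (cR * epsOfRecord ν S.flow.g n) ≤ S.B * S.C * S.Mr * S.lf.alpha0 (S.flow.g n))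
    (hsN : ∀ n, 1 ≤ n → n ≤ k + 1 → ((B14.Eq213MaximalDomains.side (F.P K).L M n : ℕ) : ℤ) < (F.P K).sitesPerDir 0)
    (s : SeqOfRecord F ν M S.flow.g K k) (hsep : Sect2.SeqSeparated ν.M₁ s) (hM₁ : 0 < ν.M₁) (hadm : Adm ν M S.flow.g K k s) {W : MSField (F.P K) (SU N)}
    (hcube : ∀ j, 1 ≤ j → j ≤ k → ∀ X : (Sect2.domSys (F.P K) M j).Dom, Sect2.domSites (F.P K) M j X ⊆ s.Λ j →
      ∀ a ∈ cubeIndices (F.P K) (B14.Eq213MaximalDomains.side (F.P K).L M (j + 1)),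
        (cubeEnl (F.P K) (B14.Eq213MaximalDomains.side (F.P K).L M (j + 1)) a 0 ∩ Sect2.domSites (F.P K) M j X).Nonempty →
        cubeEnl (F.P K) (B14.Eq213MaximalDomains.side (F.P K).L M (j + 1)) a 0 ⊆ s.Ω j)
    (h7 : Sect2.DataSmall7PTop (avOfRecord F N K) s.Ω (Sup ν K s.Ω) k (fun n => cR * epsOfRecord ν S.flow.g n) W)
    {U₀ : GaugeField (F.P K) 0 (SU N)} (hmin : IsMinimizer (avOfRecord F N K)
      {U | (∀ n, n ≤ k → PlaqSmallOn (Sect2.omegaPlaqsTop s.Ω (Sup ν K s.Ω) n) (ν.εreg * (F.P K).eta n ^ 2) U) ∧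
        Sect2.CoDivClassOnTop s.Ω (Sup ν K s.Ω) k ν.εreg U} (genSet s.Ω k) W U₀) :
    ∀ j, 1 ≤ j → j ≤ k → ∀ X : (Sect2.domSys (F.P K) M j).Dom,
      (Sect2.domSites (F.P K) M j X ⊆ s.Λ j →
        Sect2.ofBackgroundC S.ι (U₀) ∈
          Sect2.spaceI S (Sect2.Residual.unit (F.P K) (MatA N)) M j (Sect2.domSites (F.P K) M j X) (S.lf.alpha0 (S.flow.g j)) (S.lf.alpha1 (S.flow.g j))) ∧
      (Sect2.admB (F.P K) ν M S.flow.g s.Ω s.Λ j (Sect2.domSites (F.P K) M j X) = true →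
        Sect2.ofBackgroundC S.ι (U₀) ∈
          Sect2.spaceMS S (Sect2.Residual.unit (F.P K) (MatA N)) M j (Sect2.domSites (F.P K) M j X) s.Ω) := by
  have hplaq := plaqSmallOn_of_thm1RegSepTop7MG h15 ν M S.flow.g K k cR s hsep hM₁ hadm hnum ha₀ hcomp hcomp' h7 hmin
  have hclass : ∀ n, 1 ≤ n → n ≤ k → PlaqSmallOn (omegaPlaqs s.Ω n) (B₃ * (cR * epsOfRecord ν S.flow.g n) * (F.P K).eta n ^ 2) U₀ := by
    intro n hn1 hnk
    have := hplaq n hnk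
    rwa [Sect2.omegaPlaqsTop_of_ne_zero _ _ (Nat.one_le_iff_ne_zero.mp hn1)] at this
  have hg := localGaugeOn_of_thm1GaugeRegSepTop7MG h15G ν S.flow.g K k cR s hsep hM₁ hadm hnum ha₀ hcomp hcomp' h7 hmin
  exact bgRowAtDatumU_of_classBoundsPos_of_localGauge_of_hcubeΩ S hι h𝓜 hS hpos ν K k s U₀ hcube hclass hα hBα htI htMS
    (fun n hn1 hnk => (hg n hn1 hnk).1 (hsN n hn1 (by omega))) (fun n hn1 hnk => (hg n hn1 hnk).2 (hsN (n + 1) (by omega) (by omega)))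

/-- **§2 ★★ ROW P11's BODY AT `(s, 𝐖)` FOR def-R's COLLAR-CLASS MINIMISER `UbgMSCoPOfRecord … s 𝐖` AT A PREFIX PASSING THE GUARD — `hcubeΩ` AS A HYPOTHESIS** (54 §3's ★★★
`bgRowAtDatumCoP_of_thm1RegSepCoP7MG_of_thm1GaugeG` with (C1)∕(C2) ↦ `hcube`, `hM` dropped; on the solvable set §1 at `isMinimizer_UbgMSCoPOfRecord`, off it the junk `1` by
`bgRowAtDatum_one`).  The (8)-G `CoP` sentence is 49's `VariationalThm1RegSepCoP7MG` (= the top-domain sentence at `Sup := suppDomOfRecord`, definitional).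
[cite: Balaban1985Variational, Thm 1 (2),(6)–(9) pp.278–279, p.304 lines 1–2; Balaban1988Convergent, (2.6)–(2.8) pp.255–256, (2.12)–(2.13) p.256, (2.27)–(2.28) p.259, (2.34)–(2.41) p.261; Balaban1987RG1, (0.1) p.251, (1.11)–(1.16) p.262] -/
theorem bgRowAtDatumCoP_of_thm1RegSepCoP7MG_of_thm1GaugeG_of_hcubeΩ {M : ℕ} {Adm : StepGuard F} {B₃ B₃' a₀ a₁ : ℝ} (h15 : VariationalThm1RegSepCoP7MG F N Adm B₃ a₀ a₁)
    (h15G : VariationalThm1GaugeRegSepCoP7MG F N M Adm B₃ B₃' a₀ a₁)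
    (S : Sect2.Setting (MatA N) (SU N)) (hι : S.ι = ιSU N) (h𝓜 : S.𝓜 = B12RegularSpaces111SpecialUnitary.suModel N) (hS : S.Laws) (hpos : S.Pos)
    (ν : Stage7Numerics) (K k : ℕ) (cR : ℝ)
    (hnum : ∀ n, n ≤ k → 0 < cR * epsOfRecord ν S.flow.g n ∧ cR * epsOfRecord ν S.flow.g n ≤ a₁ ∧ B₃ * (cR * epsOfRecord ν S.flow.g n) ≤ ν.εreg)
    (ha₀ : ν.εreg ≤ a₀) (hcomp : ∀ n, n < k → cR * epsOfRecord ν S.flow.g n ≤ 2 * (cR * epsOfRecord ν S.flow.g (n + 1)))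
    (hcomp' : ∀ n, n < k → cR * epsOfRecord ν S.flow.g (n + 1) ≤ 2 * (cR * epsOfRecord ν S.flow.g n))
    (hα : ∀ n, 1 ≤ n → n ≤ k → 0 < S.lf.alpha0 (S.flow.g n) ∧ 0 < S.lf.alpha1 (S.flow.g n))
    (hBα : ∀ n, 1 ≤ n → n ≤ k → B₃ * (cR * epsOfRecord ν S.flow.g n) ≤ (1 - S.βc) * S.lf.alpha0 (S.flow.g n))
    (htI : ∀ n, 1 ≤ n → n ≤ k → B₃' * (cR * epsOfRecord ν S.flow.g n) ≤ S.cB * S.lf.alpha0 (S.flow.g n))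
    (htMS : ∀ n, 1 ≤ n → n ≤ k → B₃' * (cR * epsOfRecord ν S.flow.g n) ≤ S.B * S.C * S.Mr * S.lf.alpha0 (S.flow.g n))
    (hsN : ∀ n, 1 ≤ n → n ≤ k + 1 → ((B14.Eq213MaximalDomains.side (F.P K).L M n : ℕ) : ℤ) < (F.P K).sitesPerDir 0)
    (s : SeqOfRecord F ν M S.flow.g K k) (hsep : Sect2.SeqSeparated ν.M₁ s) (hM₁ : 0 < ν.M₁) (hadm : Adm ν M S.flow.g K k s) (W : MSField (F.P K) (SU N))
    (hcube : ∀ j, 1 ≤ j → j ≤ k → ∀ X : (Sect2.domSys (F.P K) M j).Dom, Sect2.domSites (F.P K) M j X ⊆ s.Λ j →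
      ∀ a ∈ cubeIndices (F.P K) (B14.Eq213MaximalDomains.side (F.P K).L M (j + 1)),
        (cubeEnl (F.P K) (B14.Eq213MaximalDomains.side (F.P K).L M (j + 1)) a 0 ∩ Sect2.domSites (F.P K) M j X).Nonempty →
        cubeEnl (F.P K) (B14.Eq213MaximalDomains.side (F.P K).L M (j + 1)) a 0 ⊆ s.Ω j)
    (h7 : Sect2.DataSmall7PTop (avOfRecord F N K) s.Ω (suppDomOfRecord F ν K s.Ω) k (fun n => cR * epsOfRecord ν S.flow.g n) W) :
    ∀ j, 1 ≤ j → j ≤ k → ∀ X : (Sect2.domSys (F.P K) M j).Dom,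
      (Sect2.domSites (F.P K) M j X ⊆ s.Λ j →
        Sect2.ofBackgroundC S.ι (UbgMSCoPOfRecord F N ν M S.flow.g K k s W) ∈
          Sect2.spaceI S (Sect2.Residual.unit (F.P K) (MatA N)) M j (Sect2.domSites (F.P K) M j X) (S.lf.alpha0 (S.flow.g j)) (S.lf.alpha1 (S.flow.g j))) ∧
      (Sect2.admB (F.P K) ν M S.flow.g s.Ω s.Λ j (Sect2.domSites (F.P K) M j X) = true →
        Sect2.ofBackgroundC S.ι (UbgMSCoPOfRecord F N ν M S.flow.g K k s W) ∈
          Sect2.spaceMS S (Sect2.Residual.unit (F.P K) (MatA N)) M j (Sect2.domSites (F.P K) M j X) s.Ω) := by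
  by_cases hsol : W ∈ solvableDom (avOfRecord F N K) (regMSCoPOfRecord F N ν K k s.Ω) (genSet s.Ω k)
  · exact bgRowAtDatumU_of_thm1RegSepTop7MG_of_thm1GaugeG_of_hcubeΩ h15 h15G S hι h𝓜 hS hpos ν K k cR hnum ha₀ hcomp hcomp' hα hBα htI htMS hsN s hsep hM₁ hadm
      hcube h7
      (isMinimizer_UbgMSCoPOfRecord ν M S.flow.g K k s hsol)
  · rw [UbgMSCoPOfRecord_eq_one_of_not_mem ν M S.flow.g K k s hsol]
    exact bgRowAtDatum_one S hpos ν M K k s hα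


end RowBodyG

/-! ## §3  The Stage-13 lift — guard as an INNER antecedent, NO `PartCompat₁₃` antecedent -/

section Stage13G

/-- **§3 ★★ ROW P11's BODY AT `UbgMSCoPOfRecord … n s 𝐖` AT THE STAGE-13 RECORD FROM THE GUARDED LETTERS, AT EVERY WINDOW PREFIX `(p, n, s)` PASSING THE GUARD — NO RUN GUARD IN
THE CONCLUSION, `hcubeΩ` RUN-INDEXED AS A HYPOTHESIS** (54 §5's `Stage13Params.bgAtDatumCoP_of_thm1RegSepCoP7MG_of_thm1GaugeG` with the antecedent `PartCompat₁₃ F N θ p n →`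
DELETED and (C1) replaced by `hcube`; the guard enters exactly as there, as the inner antecedent `Adm θ.ν θ.τ9.M (gOfRecord₁₃ F N θ p) p.K n s` right after `0 < θ.ν.M₁`,
discharged per prefix by the consumer; `hsN` kept as stated — at `θ.τ9.M = F.L^a`, `a + 1 ≤ m` it holds on every run; equivalently p623895 §4 with `hc ↦` the inner `Adm`
antecedent and R ↦ G letters).  A REDUCTION — the two sentences are hypotheses, never asserted.
[cite: Balaban1985Variational, (6)–(7) p.278, Thm 1 (8)–(9) p.279, (152) p.301, Prop. 8 p.304, p.304 lines 1–2; Balaban1985RegularSpaces, (1.3)–(1.9) p.77; Balaban1988Convergent, Thm 1 p.262, (2.4)–(2.8) pp.255–256, (2.12)–(2.13) p.256, (2.27)–(2.28) p.259; Balaban1987RG1, (0.1) p.251, Thm 1 p.259, (1.12) p.262] -/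
theorem stage13_bgAtDatumCoP_of_thm1RegSepCoP7MG_of_thm1GaugeG_of_hcubeΩ (θ : Stage13Params F N) (hθ : θ.Admissible F N) (hRz : θ.Rz = RzOfRecord F N)
    {Adm : StepGuard F} {B₃ B₃' a₀ a₁ : ℝ}
    (h15 : VariationalThm1RegSepCoP7MG F N Adm B₃ a₀ a₁) (h15G : VariationalThm1GaugeRegSepCoP7MG F N θ.τ9.M Adm B₃ B₃' a₀ a₁)
    (hnum : ∀ (p : B12.RunParams) (n : ℕ), n ≤ p.K → Step.InInterval θ.γ n (gOfRecord₁₃ F N θ p) → ∀ m, m ≤ n →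
      0 < θ.s2.cR * epsOfRecord θ.ν (gOfRecord₁₃ F N θ p) m ∧ θ.s2.cR * epsOfRecord θ.ν (gOfRecord₁₃ F N θ p) m ≤ a₁ ∧ B₃ * (θ.s2.cR * epsOfRecord θ.ν (gOfRecord₁₃ F N θ p) m) ≤ θ.ν.εreg)
    (ha₀ : θ.ν.εreg ≤ a₀)
    (hcomp : ∀ (p : B12.RunParams) (n : ℕ), n ≤ p.K → Step.InInterval θ.γ n (gOfRecord₁₃ F N θ p) → ∀ m, m < n →
      θ.s2.cR * epsOfRecord θ.ν (gOfRecord₁₃ F N θ p) m ≤ 2 * (θ.s2.cR * epsOfRecord θ.ν (gOfRecord₁₃ F N θ p) (m + 1)))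
    (hcomp' : ∀ (p : B12.RunParams) (n : ℕ), n ≤ p.K → Step.InInterval θ.γ n (gOfRecord₁₃ F N θ p) → ∀ m, m < n →
      θ.s2.cR * epsOfRecord θ.ν (gOfRecord₁₃ F N θ p) (m + 1) ≤ 2 * (θ.s2.cR * epsOfRecord θ.ν (gOfRecord₁₃ F N θ p) m))
    (hBα : ∀ (p : B12.RunParams) (n : ℕ), n ≤ p.K → Step.InInterval θ.γ n (gOfRecord₁₃ F N θ p) → ∀ m, 1 ≤ m → m ≤ n →
      B₃ * (θ.s2.cR * epsOfRecord θ.ν (gOfRecord₁₃ F N θ p) m) ≤ (1 - θ.s2.βc) * (lfOfRecord₁₂ F N θ.toStage12Params).alpha0 (gOfRecord₁₃ F N θ p m))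
    (htI : ∀ (p : B12.RunParams) (n : ℕ), n ≤ p.K → Step.InInterval θ.γ n (gOfRecord₁₃ F N θ p) → ∀ m, 1 ≤ m → m ≤ n →
      B₃' * (θ.s2.cR * epsOfRecord θ.ν (gOfRecord₁₃ F N θ p) m) ≤ θ.s2.cB * (lfOfRecord₁₂ F N θ.toStage12Params).alpha0 (gOfRecord₁₃ F N θ p m))
    (htMS : ∀ (p : B12.RunParams) (n : ℕ), n ≤ p.K → Step.InInterval θ.γ n (gOfRecord₁₃ F N θ p) → ∀ m, 1 ≤ m → m ≤ n →
      B₃' * (θ.s2.cR * epsOfRecord θ.ν (gOfRecord₁₃ F N θ p) m) ≤ θ.s2.B * θ.s2.C * θ.s2.Mr * (lfOfRecord₁₂ F N θ.toStage12Params).alpha0 (gOfRecord₁₃ F N θ p m))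
    (hcube : ∀ (p : B12.RunParams) (n : ℕ), n ≤ p.K → Step.InInterval θ.γ n (gOfRecord₁₃ F N θ p) →
      ∀ s : SeqOfRecord F θ.ν θ.τ9.M (gOfRecord₁₃ F N θ p) p.K n, ∀ j, 1 ≤ j → j ≤ n →
      ∀ X : (Sect2.domSys (F.P p.K) θ.τ9.M j).Dom, Sect2.domSites (F.P p.K) θ.τ9.M j X ⊆ s.Λ j →
      ∀ a ∈ cubeIndices (F.P p.K) (B14.Eq213MaximalDomains.side (F.P p.K).L θ.τ9.M (j + 1)),
        (cubeEnl (F.P p.K) (B14.Eq213MaximalDomains.side (F.P p.K).L θ.τ9.M (j + 1)) a 0 ∩ Sect2.domSites (F.P p.K) θ.τ9.M j X).Nonempty →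
        cubeEnl (F.P p.K) (B14.Eq213MaximalDomains.side (F.P p.K).L θ.τ9.M (j + 1)) a 0 ⊆ s.Ω j)
    (hsN : ∀ (p : B12.RunParams) (n : ℕ), n ≤ p.K → ∀ n', 1 ≤ n' → n' ≤ n + 1 →
      ((B14.Eq213MaximalDomains.side (F.P p.K).L θ.τ9.M n' : ℕ) : ℤ) < (F.P p.K).sitesPerDir 0) :
    ∀ (p : B12.RunParams) (n : ℕ), n ≤ p.K → Step.InInterval θ.γ n (gOfRecord₁₃ F N θ p) →
      ∀ s : SeqOfRecord F θ.ν θ.τ9.M (gOfRecord₁₃ F N θ p) p.K n, Sect2.SeqSeparated θ.ν.M₁ s → 0 < θ.ν.M₁ →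
      Adm θ.ν θ.τ9.M (gOfRecord₁₃ F N θ p) p.K n s → ∀ W : MSField (F.P p.K) (SU N),
      Sect2.DataSmall7PTop (avOfRecord F N p.K) s.Ω (suppDomOfRecord F θ.ν p.K s.Ω) n (fun j => θ.s2.cR * epsOfRecord θ.ν (gOfRecord₁₃ F N θ p) j) W →
      ∀ j, 1 ≤ j → j ≤ n → ∀ X : (Sect2.domSys (F.P p.K) θ.τ9.M j).Dom,
      (Sect2.domSites (F.P p.K) θ.τ9.M j X ⊆ s.Λ j →
        Sect2.ofBackgroundC (settingOfRecord₁₃ F N θ p).ι (UbgMSCoPOfRecord F N θ.ν θ.τ9.M (gOfRecord₁₃ F N θ p) p.K n s W) ∈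
          Sect2.spaceI (settingOfRecord₁₃ F N θ p) (θ.Rz p.K) θ.τ9.M j (Sect2.domSites (F.P p.K) θ.τ9.M j X)
            ((settingOfRecord₁₃ F N θ p).lf.alpha0 ((settingOfRecord₁₃ F N θ p).flow.g j)) ((settingOfRecord₁₃ F N θ p).lf.alpha1 ((settingOfRecord₁₃ F N θ p).flow.g j))) ∧
      (Sect2.admB (F.P p.K) θ.ν θ.τ9.M (gOfRecord₁₃ F N θ p) s.Ω s.Λ j (Sect2.domSites (F.P p.K) θ.τ9.M j X) = true →
        Sect2.ofBackgroundC (settingOfRecord₁₃ F N θ p).ι (UbgMSCoPOfRecord F N θ.ν θ.τ9.M (gOfRecord₁₃ F N θ p) p.K n s W) ∈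
          Sect2.spaceMS (settingOfRecord₁₃ F N θ p) (θ.Rz p.K) θ.τ9.M j (Sect2.domSites (F.P p.K) θ.τ9.M j X) s.Ω) := by
  intro p n hn hw s hsep hM₁ hadm W h7
  rw [hRz]
  exact bgRowAtDatumCoP_of_thm1RegSepCoP7MG_of_thm1GaugeG_of_hcubeΩ h15 h15G (settingOfRecord₁₃ F N θ p) rfl rfl (settingOfRecord₁₃_laws F N θ p)
    (settingOfRecord₁₃_pos F N θ hθ.1.pos p) θ.ν p.K n θ.s2.cR (hnum p n hn hw) ha₀ (hcomp p n hn hw) (hcomp' p n hn hw)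
    (fun m _ hm => alphaPos₁₃_of_inInterval hθ hw hm) (hBα p n hn hw) (htI p n hn hw) (htMS p n hn hw) (hsN p n hn) s hsep hM₁ hadm W (hcube p n hn hw s) h7

end Stage13G

/-! ## §4–§5  At K1's witness of record `θ₁₅ᶜᶜᴹᵂ(j; γ)`, non-wrapping families, ANY guard met on the window prefixes — `hcube` discharged, NO `PartCompat₁₃` -/

section WitnessG

variable {j c c₀ : ℕ} {γ ε₀ ε₂₉ B₃ B₃' a₀ a₁ : ℝ}

/-- **§4 ★★★ AT K1's WITNESS `θ₁₅ᶜᶜᴹᵂ(j; γ)` ON A NON-WRAPPING FAMILY (`j + 1 ≤ F.m`), GUARDED LETTERS, ANY GUARD `Adm` MET ON THE WINDOW PREFIXES (`hadm`): THE (7)-GUARDED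
SEPARATED ROW P11 BODY ON EVERY WINDOW RUN — NO RUN GUARD, NO GEOMETRIC HYPOTHESIS** (p626404 §2's statement with (8) ↦ (8)-G `VariationalThm1RegSepCoP7MG F N Adm`, (9)-R ↦ (9)-G
`VariationalThm1GaugeRegSepCoP7MG F N (F.L ^ j) Adm`, the floor letter `hc : c ≤ F.L ^ j` ↦ `hadm`; proof = p623895 §5's term through §3, `hcube` DISCHARGED by p626404 §1
`hcube_theta13OfThm1CCMW_of_window` (dag-n11-w4's «BG-ONEBLOCK» `hcubeΩ_of_powM` at `M = L^j` ∘ A2ʷ (C1)), `hsN` from `hjm`).  The wrapping families `F.m ≤ j` are NOT served (there the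
(1.12) cubes wrap).  CONDITIONAL; nothing of Bałaban asserted.
[cite: Balaban1985Variational, (6)–(7) p.278, Thm 1 (8)–(9) p.279, (144)–(152) pp.300–301, Prop. 8 p.304, p.304 lines 1–2; Balaban1985RegularSpaces, (1.3)–(1.9) p.77; Balaban1988Convergent, Thm 1 p.262, (2.1) p.254, (2.4)–(2.8) pp.255–256, (2.28) p.259, p.257; Balaban1987RG1, (0.1) p.251, Thm 1 p.259, (1.12) p.262] -/
theorem bgSepCoPAt_theta13OfThm1CCMW_of_thm1GaugeG_of_hadm_of_hcomp_of_hjm {Adm : StepGuard F} (hγ0 : 0 < γ) (hγ : γ ≤ 1 / 2) (hjm : j + 1 ≤ F.m) (hε : 0 < ε₀) (hε' : 0 < ε₂₉) (hB : 0 ≤ B₃) (hB' : 0 ≤ B₃') (ha₀ : 0 < a₀) (ha₁ : 0 < a₁)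
    (h15 : VariationalThm1RegSepCoP7MG F N Adm B₃ a₀ a₁) (h15G : VariationalThm1GaugeRegSepCoP7MG F N (F.L ^ j) Adm B₃ B₃' a₀ a₁)
    (hadm : ∀ (p : B12.RunParams) (n : ℕ), n ≤ p.K → Step.InInterval (theta13OfThm1CCMW F N j γ ε₀ ε₂₉ B₃ B₃' a₀ a₁).γ n (gOfRecord₁₃ F N (theta13OfThm1CCMW F N j γ ε₀ ε₂₉ B₃ B₃' a₀ a₁) p) →
      ∀ s : SeqOfRecord F (theta13OfThm1CCMW F N j γ ε₀ ε₂₉ B₃ B₃' a₀ a₁).ν (theta13OfThm1CCMW F N j γ ε₀ ε₂₉ B₃ B₃' a₀ a₁).τ9.M (gOfRecord₁₃ F N (theta13OfThm1CCMW F N j γ ε₀ ε₂₉ B₃ B₃' a₀ a₁) p) p.K n, Adm (theta13OfThm1CCMW F N j γ ε₀ ε₂₉ B₃ B₃' a₀ a₁).ν (theta13OfThm1CCMW F N j γ ε₀ ε₂₉ B₃ B₃' a₀ a₁).τ9.M (gOfRecord₁₃ F N (theta13OfThm1CCMW F N j γ ε₀ ε₂₉ B₃ B₃' a₀ a₁)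 p) p.K n s)
    (hcomp : ∀ (p : B12.RunParams) (n : ℕ), n ≤ p.K → Step.InInterval (theta13OfThm1CCMW F N j γ ε₀ ε₂₉ B₃ B₃' a₀ a₁).γ n (gOfRecord₁₃ F N (theta13OfThm1CCMW F N j γ ε₀ ε₂₉ B₃ B₃' a₀ a₁) p) → ∀ m, m < n →
      (theta13OfThm1CCMW F N j γ ε₀ ε₂₉ B₃ B₃' a₀ a₁).s2.cR * epsOfRecord (theta13OfThm1CCMW F N j γ ε₀ ε₂₉ B₃ B₃' a₀ a₁).ν (gOfRecord₁₃ F N (theta13OfThm1CCMW F N j γ ε₀ ε₂₉ B₃ B₃' a₀ a₁) p) m ≤ 2 * ((theta13OfThm1CCMW F N j γ ε₀ ε₂₉ B₃ B₃' a₀ a₁).s2.cR * epsOfRecord (theta13OfThm1CCMW F N j γ ε₀ ε₂₉ B₃ B₃' a₀ a₁).ν (gOfRecord₁₃ F N (theta13OfThm1CCMW F N j γ ε₀ ε₂₉ B₃ B₃' a₀ a₁) p) (m + 1)))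
    (hcompRev : ∀ (p : B12.RunParams) (n : ℕ), n ≤ p.K → Step.InInterval (theta13OfThm1CCMW F N j γ ε₀ ε₂₉ B₃ B₃' a₀ a₁).γ n (gOfRecord₁₃ F N (theta13OfThm1CCMW F N j γ ε₀ ε₂₉ B₃ B₃' a₀ a₁) p) → ∀ m, m < n →
      (theta13OfThm1CCMW F N j γ ε₀ ε₂₉ B₃ B₃' a₀ a₁).s2.cR * epsOfRecord (theta13OfThm1CCMW F N j γ ε₀ ε₂₉ B₃ B₃' a₀ a₁).ν (gOfRecord₁₃ F N (theta13OfThm1CCMW F N j γ ε₀ ε₂₉ B₃ B₃' a₀ a₁) p) (m + 1) ≤ 2 * ((theta13OfThm1CCMW F N j γ ε₀ ε₂₉ B₃ B₃' a₀ a₁).s2.cR * epsOfRecord (theta13OfThm1CCMW F N j γ ε₀ ε₂₉ B₃ B₃' a₀ a₁).ν (gOfRecord₁₃ F N (theta13OfThm1CCMW F N j γ ε₀ ε₂₉ B₃ B₃' a₀ a₁) p) m)) :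
    ∀ (p : B12.RunParams) (n : ℕ), n ≤ p.K → Step.InInterval (theta13OfThm1CCMW F N j γ ε₀ ε₂₉ B₃ B₃' a₀ a₁).γ n (gOfRecord₁₃ F N (theta13OfThm1CCMW F N j γ ε₀ ε₂₉ B₃ B₃' a₀ a₁) p) →
      ∀ s : SeqOfRecord F (theta13OfThm1CCMW F N j γ ε₀ ε₂₉ B₃ B₃' a₀ a₁).ν (theta13OfThm1CCMW F N j γ ε₀ ε₂₉ B₃ B₃' a₀ a₁).τ9.M (gOfRecord₁₃ F N (theta13OfThm1CCMW F N j γ ε₀ ε₂₉ B₃ B₃' a₀ a₁) p) p.K n, Sect2.SeqSeparated (theta13OfThm1CCMW F N j γ ε₀ ε₂₉ B₃ B₃' a₀ a₁).ν.M₁ s →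
      ∀ W : MSField (F.P p.K) (SU N), W ∈ suppOfRecord₁₃P F N (theta13OfThm1CCMW F N j γ ε₀ ε₂₉ B₃ B₃' a₀ a₁) p n s →
      Sect2.DataSmall7PTop (avOfRecord F N p.K) s.Ω (suppDomOfRecord F (theta13OfThm1CCMW F N j γ ε₀ ε₂₉ B₃ B₃' a₀ a₁).ν p.K s.Ω) n (fun j' => (theta13OfThm1CCMW F N j γ ε₀ ε₂₉ B₃ B₃' a₀ a₁).s2.cR * epsOfRecord (theta13OfThm1CCMW F N j γ ε₀ ε₂₉ B₃ B₃' a₀ a₁).ν (gOfRecord₁₃ F N (theta13OfThm1CCMW F N j γ ε₀ ε₂₉ B₃ B₃' a₀ a₁) p) j') W →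
      ∀ j', 1 ≤ j' → j' ≤ n → ∀ X : (Sect2.domSys (F.P p.K) (theta13OfThm1CCMW F N j γ ε₀ ε₂₉ B₃ B₃' a₀ a₁).τ9.M j').Dom,
      (Sect2.domSites (F.P p.K) (theta13OfThm1CCMW F N j γ ε₀ ε₂₉ B₃ B₃' a₀ a₁).τ9.M j' X ⊆ s.Λ j' →
        Sect2.ofBackgroundC (settingOfRecord₁₃ F N (theta13OfThm1CCMW F N j γ ε₀ ε₂₉ B₃ B₃' a₀ a₁) p).ι (UbgOfRecord₁₃CoP F N (theta13OfThm1CCMW F N j γ ε₀ ε₂₉ B₃ B₃' a₀ a₁) p n s W) ∈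
          Sect2.spaceI (settingOfRecord₁₃ F N (theta13OfThm1CCMW F N j γ ε₀ ε₂₉ B₃ B₃' a₀ a₁) p) ((theta13OfThm1CCMW F N j γ ε₀ ε₂₉ B₃ B₃' a₀ a₁).Rz p.K) (theta13OfThm1CCMW F N j γ ε₀ ε₂₉ B₃ B₃' a₀ a₁).τ9.M j' (Sect2.domSites (F.P p.K) (theta13OfThm1CCMW F N j γ ε₀ ε₂₉ B₃ B₃' a₀ a₁).τ9.M j' X)
            ((settingOfRecord₁₃ F N (theta13OfThm1CCMW F N j γ ε₀ ε₂₉ B₃ B₃' a₀ a₁) p).lf.alpha0 ((settingOfRecord₁₃ F N (theta13OfThm1CCMW F N j γ ε₀ ε₂₉ B₃ B₃' a₀ a₁) p).flow.g j')) ((settingOfRecord₁₃ F N (theta13OfThm1CCMW F N j γ ε₀ ε₂₉ B₃ B₃' a₀ a₁) p).lf.alpha1 ((settingOfRecord₁₃ F N (theta13OfThm1CCMW F N j γ ε₀ ε₂₉ B₃ B₃' a₀ a₁) p).flow.g j'))) ∧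
      (Sect2.admB (F.P p.K) (theta13OfThm1CCMW F N j γ ε₀ ε₂₉ B₃ B₃' a₀ a₁).ν (theta13OfThm1CCMW F N j γ ε₀ ε₂₉ B₃ B₃' a₀ a₁).τ9.M (gOfRecord₁₃ F N (theta13OfThm1CCMW F N j γ ε₀ ε₂₉ B₃ B₃' a₀ a₁) p) s.Ω s.Λ j' (Sect2.domSites (F.P p.K) (theta13OfThm1CCMW F N j γ ε₀ ε₂₉ B₃ B₃' a₀ a₁).τ9.M j' X) = true →
        Sect2.ofBackgroundC (settingOfRecord₁₃ F N (theta13OfThm1CCMW F N j γ ε₀ ε₂₉ B₃ B₃' a₀ a₁) p).ι (UbgOfRecord₁₃CoP F N (theta13OfThm1CCMW F N j γ ε₀ ε₂₉ B₃ B₃' a₀ a₁) p n s W) ∈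
          Sect2.spaceMS (settingOfRecord₁₃ F N (theta13OfThm1CCMW F N j γ ε₀ ε₂₉ B₃ B₃' a₀ a₁) p) ((theta13OfThm1CCMW F N j γ ε₀ ε₂₉ B₃ B₃' a₀ a₁).Rz p.K) (theta13OfThm1CCMW F N j γ ε₀ ε₂₉ B₃ B₃' a₀ a₁).τ9.M j' (Sect2.domSites (F.P p.K) (theta13OfThm1CCMW F N j γ ε₀ ε₂₉ B₃ B₃' a₀ a₁).τ9.M j' X) s.Ω) := by
  intro p n hn hw s hsep W _ h7
  cases n with
  | zero => intro j' h1 hj'; exfalso; omega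
  | succ n =>
    rw [UbgOfRecord₁₃CoP_succ]
    exact stage13_bgAtDatumCoP_of_thm1RegSepCoP7MG_of_thm1GaugeG_of_hcubeΩ (theta13OfThm1CCMW F N j γ ε₀ ε₂₉ B₃ B₃' a₀ a₁) (admissible_theta13OfThm1CCMW_of_le_half F N hγ0 hγ hε hε' hB hB' ha₀ ha₁) rfl
      h15 h15G (hnum_theta13OfThm1CCMW hγ hB hB' ha₀ ha₁) εreg_le_theta13OfThm1CCMW
      hcomp hcompRev (hBα_theta13OfThm1CCMW hγ hB hB' ha₀.le ha₁.le)
      (htI_theta13OfThm1CCMW hγ hB hB' ha₀.le ha₁.le) (htMS_theta13OfThm1CCMW hγ hB hB' ha₀.le ha₁.le) (hcube_theta13OfThm1CCMW_of_window hγ)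
      (hsN_theta13OfThm1CCMW F N γ ε₀ ε₂₉ B₃ B₃' a₀ a₁ hjm)
      p (n + 1) hn hw s hsep (M₁_pos_theta13OfThm1CCMW F N j γ ε₀ ε₂₉ B₃ B₃' a₀ a₁) (hadm p (n + 1) hn hw s) W h7

/-- **§5 ★★★ ROW P11 `bg` IN ITS OWN CURRENCY AT K1's WITNESS FROM THE GUARDED LETTERS, ANY GUARD MET ON THE WINDOW PREFIXES, NON-WRAPPING FAMILIES, EVERY WINDOW RUN — NO RUN
GUARD**: def-R's ranged proviso `BgProvisoΛ F N p.K (settingOfRecord₁₃ …) (θ.Rz p.K) θ.τ9.M n (suppOfRecord₁₃SepCoP …) (UbgOfRecord₁₃CoP …)` — the exact TYPE of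
`Provisos₁₃SepCoPH.bg`'s consequent and of dag-n11-w1's `hbg(s)` binders (`…OfBgFact(s)`) — at `θ := θ₁₅ᶜᶜᴹᵂ(j; γ)`, `j + 1 ≤ F.m`, from §4 through K0a's support adapter
(membership in `suppOfRecord₁₃SepCoP` = ⟨regular support, separation, (7)-regularity⟩).  p626404 §3's statement with R ↦ G letters and `hc ↦ hadm`.  CONDITIONAL; nothing of Bałaban asserted.
[cite: Balaban1988Convergent, (2.28) p.259, (2.18) p.257, Thm 1 p.262; Balaban1985Variational, (6)–(7) p.278, Thm 1 (8)–(9) p.279, p.304 lines 1–2; Balaban1985RegularSpaces, (1.3)–(1.6) p.77; Balaban1987RG1, (0.1) p.251] -/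
theorem bgProvisoΛ_theta13OfThm1CCMW_of_thm1GaugeG_of_hadm_of_hcomp_of_hjm {Adm : StepGuard F} (hγ0 : 0 < γ) (hγ : γ ≤ 1 / 2) (hjm : j + 1 ≤ F.m) (hε : 0 < ε₀) (hε' : 0 < ε₂₉) (hB : 0 ≤ B₃) (hB' : 0 ≤ B₃') (ha₀ : 0 < a₀) (ha₁ : 0 < a₁)
    (h15 : VariationalThm1RegSepCoP7MG F N Adm B₃ a₀ a₁) (h15G : VariationalThm1GaugeRegSepCoP7MG F N (F.L ^ j) Adm B₃ B₃' a₀ a₁)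
    (hadm : ∀ (p : B12.RunParams) (n : ℕ), n ≤ p.K → Step.InInterval (theta13OfThm1CCMW F N j γ ε₀ ε₂₉ B₃ B₃' a₀ a₁).γ n (gOfRecord₁₃ F N (theta13OfThm1CCMW F N j γ ε₀ ε₂₉ B₃ B₃' a₀ a₁) p) →
      ∀ s : SeqOfRecord F (theta13OfThm1CCMW F N j γ ε₀ ε₂₉ B₃ B₃' a₀ a₁).ν (theta13OfThm1CCMW F N j γ ε₀ ε₂₉ B₃ B₃' a₀ a₁).τ9.M (gOfRecord₁₃ F N (theta13OfThm1CCMW F N j γ ε₀ ε₂₉ B₃ B₃' a₀ a₁) p) p.K n, Adm (theta13OfThm1CCMW F N j γ ε₀ ε₂₉ B₃ B₃' a₀ a₁).ν (theta13OfThm1CCMW F N j γ ε₀ ε₂₉ B₃ B₃' a₀ a₁).τ9.M (gOfRecord₁₃ F N (theta13OfThm1CCMW F N j γ ε₀ ε₂₉ B₃ B₃' a₀ a₁) p) p.K n s)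
    (hcomp : ∀ (p : B12.RunParams) (n : ℕ), n ≤ p.K → Step.InInterval (theta13OfThm1CCMW F N j γ ε₀ ε₂₉ B₃ B₃' a₀ a₁).γ n (gOfRecord₁₃ F N (theta13OfThm1CCMW F N j γ ε₀ ε₂₉ B₃ B₃' a₀ a₁) p) → ∀ m, m < n →
      (theta13OfThm1CCMW F N j γ ε₀ ε₂₉ B₃ B₃' a₀ a₁).s2.cR * epsOfRecord (theta13OfThm1CCMW F N j γ ε₀ ε₂₉ B₃ B₃' a₀ a₁).ν (gOfRecord₁₃ F N (theta13OfThm1CCMW F N j γ ε₀ ε₂₉ B₃ B₃' a₀ a₁) p) m ≤ 2 * ((theta13OfThm1CCMW F N j γ ε₀ ε₂₉ B₃ B₃' a₀ a₁).s2.cR * epsOfRecord (theta13OfThm1CCMW F N j γ ε₀ ε₂₉ B₃ B₃' a₀ a₁).ν (gOfRecord₁₃ F N (theta13OfThm1CCMW F N j γ ε₀ ε₂₉ B₃ B₃' a₀ a₁) p) (m + 1)))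
    (hcompRev : ∀ (p : B12.RunParams) (n : ℕ), n ≤ p.K → Step.InInterval (theta13OfThm1CCMW F N j γ ε₀ ε₂₉ B₃ B₃' a₀ a₁).γ n (gOfRecord₁₃ F N (theta13OfThm1CCMW F N j γ ε₀ ε₂₉ B₃ B₃' a₀ a₁) p) → ∀ m, m < n →
      (theta13OfThm1CCMW F N j γ ε₀ ε₂₉ B₃ B₃' a₀ a₁).s2.cR * epsOfRecord (theta13OfThm1CCMW F N j γ ε₀ ε₂₉ B₃ B₃' a₀ a₁).ν (gOfRecord₁₃ F N (theta13OfThm1CCMW F N j γ ε₀ ε₂₉ B₃ B₃' a₀ a₁) p) (m + 1) ≤ 2 * ((theta13OfThm1CCMW F N j γ ε₀ ε₂₉ B₃ B₃' a₀ a₁).s2.cR * epsOfRecord (theta13OfThm1CCMW F N j γ ε₀ ε₂₉ B₃ B₃' a₀ a₁).ν (gOfRecord₁₃ F N (theta13OfThm1CCMW F N j γ ε₀ ε₂₉ B₃ B₃' a₀ a₁) p) m)) :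
    ∀ (p : B12.RunParams) (n : ℕ), n ≤ p.K → Step.InInterval (theta13OfThm1CCMW F N j γ ε₀ ε₂₉ B₃ B₃' a₀ a₁).γ n (gOfRecord₁₃ F N (theta13OfThm1CCMW F N j γ ε₀ ε₂₉ B₃ B₃' a₀ a₁) p) →
      BgProvisoΛ F N p.K (settingOfRecord₁₃ F N (theta13OfThm1CCMW F N j γ ε₀ ε₂₉ B₃ B₃' a₀ a₁) p) ((theta13OfThm1CCMW F N j γ ε₀ ε₂₉ B₃ B₃' a₀ a₁).Rz p.K) (theta13OfThm1CCMW F N j γ ε₀ ε₂₉ B₃ B₃' a₀ a₁).τ9.M n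
        (suppOfRecord₁₃SepCoP F N (theta13OfThm1CCMW F N j γ ε₀ ε₂₉ B₃ B₃' a₀ a₁) p n) (UbgOfRecord₁₃CoP F N (theta13OfThm1CCMW F N j γ ε₀ ε₂₉ B₃ B₃' a₀ a₁) p n) := by
  intro p n hn hw s W hW
  exact bgSepCoPAt_theta13OfThm1CCMW_of_thm1GaugeG_of_hadm_of_hcomp_of_hjm hγ0 hγ hjm hε hε' hB hB' ha₀ ha₁ h15 h15G hadm hcomp hcompRev
    p n hn hw s hW.2.1 W hW.1 hW.2.2

end WitnessG

/-! ## §6  At K1's witness, THE PLAN's V20-G GUARD `fun ν _ _ K k _ => c ≤ ν.M₁ ∧ k + c₀ ≤ F.m + K` — guard-free conclusions from `c ≤ L^j`, `c₀ ≤ F.m` -/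

section PlanGuard

variable {j c c₀ : ℕ} {γ ε₀ ε₂₉ B₃ B₃' a₀ a₁ : ℝ}

/-- **§6a ★★★ «BG-ONEBLOCK» UNDER THE PLAN's V20-G GUARD — THE (7)-GUARDED SEPARATED ROW P11 BODY AT θ₁₅ᶜᶜᴹᵂ(j; γ) ON EVERY WINDOW RUN, NO RUN GUARD, NO GEOMETRIC HYPOTHESIS,
NO GUARD ANTECEDENT LEFT**: §4 at `Adm := fun ν _ _ K k _ => c ≤ ν.M₁ ∧ k + c₀ ≤ F.m + K` (plan g86 WORD «V20 = G», the stub-1-G ∕ 3ᴬ′-G texts' guard; dag-n07-e p632562's A2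
witness names the same lambda), the guard DISCHARGED at every window prefix: floor half `c ≤ L^j = ν.M₁` from `hc` (`theta13OfThm1CCMW_M₁`), level half `n + c₀ ≤ F.m + p.K` from
`n ≤ p.K` and `hc₀ : c₀ ≤ F.m` (`omega`).  = p626404 §2's TYPE with (8) ↦ (8)-G, (9)-R `(L^j) c` ↦ (9)-G `(L^j) (guard c c₀)`, plus the one binder `hc₀`.  CONDITIONAL; the guard
is a CANDIDATE text (V20-G unregistered at the time of writing); nothing of Bałaban asserted.
[cite: Balaban1985Variational, (6)–(7) p.278, Thm 1 (8)–(9) p.279, Prop. 8 p.304, p.304 lines 1–2; Balaban1988Convergent, Thm 1 p.262, (2.1) p.254, (2.28) p.259, p.257; Balaban1987RG1, (0.1) p.251, Thm 1 p.259, (1.12) p.262] -/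
theorem bgSepCoPAt_theta13OfThm1CCMW_of_thm1GaugeLevelFloorG_of_hcomp_of_hjm (hγ0 : 0 < γ) (hγ : γ ≤ 1 / 2) (hjm : j + 1 ≤ F.m) (hε : 0 < ε₀) (hε' : 0 < ε₂₉) (hB : 0 ≤ B₃) (hB' : 0 ≤ B₃') (ha₀ : 0 < a₀) (ha₁ : 0 < a₁)
    (h15 : VariationalThm1RegSepCoP7MG F N (fun ν _ _ K k _ => c ≤ ν.M₁ ∧ k + c₀ ≤ F.m + K) B₃ a₀ a₁) (hc : c ≤ F.L ^ j) (hc₀ : c₀ ≤ F.m)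
    (h15G : VariationalThm1GaugeRegSepCoP7MG F N (F.L ^ j) (fun ν _ _ K k _ => c ≤ ν.M₁ ∧ k + c₀ ≤ F.m + K) B₃ B₃' a₀ a₁)
    (hcomp : ∀ (p : B12.RunParams) (n : ℕ), n ≤ p.K → Step.InInterval (theta13OfThm1CCMW F N j γ ε₀ ε₂₉ B₃ B₃' a₀ a₁).γ n (gOfRecord₁₃ F N (theta13OfThm1CCMW F N j γ ε₀ ε₂₉ B₃ B₃' a₀ a₁) p) → ∀ m, m < n →
      (theta13OfThm1CCMW F N j γ ε₀ ε₂₉ B₃ B₃' a₀ a₁).s2.cR * epsOfRecord (theta13OfThm1CCMW F N j γ ε₀ ε₂₉ B₃ B₃' a₀ a₁).ν (gOfRecord₁₃ F N (theta13OfThm1CCMW F N j γ ε₀ ε₂₉ B₃ B₃' a₀ a₁) p) m ≤ 2 * ((theta13OfThm1CCMW F N j γ ε₀ ε₂₉ B₃ B₃' a₀ a₁).s2.cR * epsOfRecord (theta13OfThm1CCMW F N j γ ε₀ ε₂₉ B₃ B₃' a₀ a₁).ν (gOfRecord₁₃ F N (theta13OfThm1CCMW F N j γ ε₀ ε₂₉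 B₃ B₃' a₀ a₁) p) (m + 1)))
    (hcompRev : ∀ (p : B12.RunParams) (n : ℕ), n ≤ p.K → Step.InInterval (theta13OfThm1CCMW F N j γ ε₀ ε₂₉ B₃ B₃' a₀ a₁).γ n (gOfRecord₁₃ F N (theta13OfThm1CCMW F N j γ ε₀ ε₂₉ B₃ B₃' a₀ a₁) p) → ∀ m, m < n →
      (theta13OfThm1CCMW F N j γ ε₀ ε₂₉ B₃ B₃' a₀ a₁).s2.cR * epsOfRecord (theta13OfThm1CCMW F N j γ ε₀ ε₂₉ B₃ B₃' a₀ a₁).ν (gOfRecord₁₃ F N (theta13OfThm1CCMW F N j γ ε₀ ε₂₉ B₃ B₃' a₀ a₁) p) (m + 1) ≤ 2 * ((theta13OfThm1CCMW F N j γ ε₀ ε₂₉ B₃ B₃' a₀ a₁).s2.cR * epsOfRecord (theta13OfThm1CCMW F N j γ ε₀ ε₂₉ B₃ B₃' a₀ a₁).ν (gOfRecord₁₃ F N (theta13OfThm1CCMW F N j γ ε₀ ε₂₉ B₃ B₃' a₀ a₁) p) m)) :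
    ∀ (p : B12.RunParams) (n : ℕ), n ≤ p.K → Step.InInterval (theta13OfThm1CCMW F N j γ ε₀ ε₂₉ B₃ B₃' a₀ a₁).γ n (gOfRecord₁₃ F N (theta13OfThm1CCMW F N j γ ε₀ ε₂₉ B₃ B₃' a₀ a₁) p) →
      ∀ s : SeqOfRecord F (theta13OfThm1CCMW F N j γ ε₀ ε₂₉ B₃ B₃' a₀ a₁).ν (theta13OfThm1CCMW F N j γ ε₀ ε₂₉ B₃ B₃' a₀ a₁).τ9.M (gOfRecord₁₃ F N (theta13OfThm1CCMW F N j γ ε₀ ε₂₉ B₃ B₃' a₀ a₁) p) p.K n, Sect2.SeqSeparated (theta13OfThm1CCMW F N j γ ε₀ ε₂₉ B₃ B₃' a₀ a₁).ν.M₁ s →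
      ∀ W : MSField (F.P p.K) (SU N), W ∈ suppOfRecord₁₃P F N (theta13OfThm1CCMW F N j γ ε₀ ε₂₉ B₃ B₃' a₀ a₁) p n s →
      Sect2.DataSmall7PTop (avOfRecord F N p.K) s.Ω (suppDomOfRecord F (theta13OfThm1CCMW F N j γ ε₀ ε₂₉ B₃ B₃' a₀ a₁).ν p.K s.Ω) n (fun j' => (theta13OfThm1CCMW F N j γ ε₀ ε₂₉ B₃ B₃' a₀ a₁).s2.cR * epsOfRecord (theta13OfThm1CCMW F N j γ ε₀ ε₂₉ B₃ B₃' a₀ a₁).ν (gOfRecord₁₃ F N (theta13OfThm1CCMW F N j γ ε₀ ε₂₉ B₃ B₃' a₀ a₁) p) j') W →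
      ∀ j', 1 ≤ j' → j' ≤ n → ∀ X : (Sect2.domSys (F.P p.K) (theta13OfThm1CCMW F N j γ ε₀ ε₂₉ B₃ B₃' a₀ a₁).τ9.M j').Dom,
      (Sect2.domSites (F.P p.K) (theta13OfThm1CCMW F N j γ ε₀ ε₂₉ B₃ B₃' a₀ a₁).τ9.M j' X ⊆ s.Λ j' →
        Sect2.ofBackgroundC (settingOfRecord₁₃ F N (theta13OfThm1CCMW F N j γ ε₀ ε₂₉ B₃ B₃' a₀ a₁) p).ι (UbgOfRecord₁₃CoP F N (theta13OfThm1CCMW F N j γ ε₀ ε₂₉ B₃ B₃' a₀ a₁) p n s W) ∈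
          Sect2.spaceI (settingOfRecord₁₃ F N (theta13OfThm1CCMW F N j γ ε₀ ε₂₉ B₃ B₃' a₀ a₁) p) ((theta13OfThm1CCMW F N j γ ε₀ ε₂₉ B₃ B₃' a₀ a₁).Rz p.K) (theta13OfThm1CCMW F N j γ ε₀ ε₂₉ B₃ B₃' a₀ a₁).τ9.M j' (Sect2.domSites (F.P p.K) (theta13OfThm1CCMW F N j γ ε₀ ε₂₉ B₃ B₃' a₀ a₁).τ9.M j' X)
            ((settingOfRecord₁₃ F N (theta13OfThm1CCMW F N j γ ε₀ ε₂₉ B₃ B₃' a₀ a₁) p).lf.alpha0 ((settingOfRecord₁₃ F N (theta13OfThm1CCMW F N j γ ε₀ ε₂₉ B₃ B₃' a₀ a₁) p).flow.g j')) ((settingOfRecord₁₃ F N (theta13OfThm1CCMW F N j γ ε₀ ε₂₉ B₃ B₃' a₀ a₁) p).lf.alpha1 ((settingOfRecord₁₃ F N (theta13OfThm1CCMW F N j γ ε₀ ε₂₉ B₃ B₃' a₀ a₁) p).flow.g j'))) ∧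
      (Sect2.admB (F.P p.K) (theta13OfThm1CCMW F N j γ ε₀ ε₂₉ B₃ B₃' a₀ a₁).ν (theta13OfThm1CCMW F N j γ ε₀ ε₂₉ B₃ B₃' a₀ a₁).τ9.M (gOfRecord₁₃ F N (theta13OfThm1CCMW F N j γ ε₀ ε₂₉ B₃ B₃' a₀ a₁) p) s.Ω s.Λ j' (Sect2.domSites (F.P p.K) (theta13OfThm1CCMW F N j γ ε₀ ε₂₉ B₃ B₃' a₀ a₁).τ9.M j' X) = true →
        Sect2.ofBackgroundC (settingOfRecord₁₃ F N (theta13OfThm1CCMW F N j γ ε₀ ε₂₉ B₃ B₃' a₀ a₁) p).ι (UbgOfRecord₁₃CoP F N (theta13OfThm1CCMW F N j γ ε₀ ε₂₉ B₃ B₃' a₀ a₁) p n s W) ∈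
          Sect2.spaceMS (settingOfRecord₁₃ F N (theta13OfThm1CCMW F N j γ ε₀ ε₂₉ B₃ B₃' a₀ a₁) p) ((theta13OfThm1CCMW F N j γ ε₀ ε₂₉ B₃ B₃' a₀ a₁).Rz p.K) (theta13OfThm1CCMW F N j γ ε₀ ε₂₉ B₃ B₃' a₀ a₁).τ9.M j' (Sect2.domSites (F.P p.K) (theta13OfThm1CCMW F N j γ ε₀ ε₂₉ B₃ B₃' a₀ a₁).τ9.M j' X) s.Ω) :=
  bgSepCoPAt_theta13OfThm1CCMW_of_thm1GaugeG_of_hadm_of_hcomp_of_hjm hγ0 hγ hjm hε hε' hB hB' ha₀ ha₁ h15 h15G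
    (fun p n hn _ _ => ⟨by rw [theta13OfThm1CCMW_M₁]; exact hc, by omega⟩) hcomp hcompRev

/-- **§6b ★★★ ROW P11 IN ITS OWN CURRENCY `BgProvisoΛ … (suppOfRecord₁₃SepCoP …) (UbgOfRecord₁₃CoP …)` AT θ₁₅ᶜᶜᴹᵂ(j; γ) UNDER THE PLAN's V20-G GUARD, EVERY WINDOW RUN — NO RUN
GUARD, NO GUARD ANTECEDENT LEFT** (§5 at the plan's guard, discharged as in §6a): the `hbg(s)` producer of dag-n11-w1's `…OfBgFact(s)` consumers at the witness once the letters
are G.  = p626404 §3's TYPE with R ↦ G letters plus `hc₀ : c₀ ≤ F.m`.  CONDITIONAL; nothing of Bałaban asserted.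
[cite: Balaban1988Convergent, (2.28) p.259, (2.18) p.257, Thm 1 p.262; Balaban1985Variational, (6)–(7) p.278, Thm 1 (8)–(9) p.279, p.304 lines 1–2; Balaban1985RegularSpaces, (1.3)–(1.6) p.77; Balaban1987RG1, (0.1) p.251] -/
theorem bgProvisoΛ_theta13OfThm1CCMW_of_thm1GaugeLevelFloorG_of_hcomp_of_hjm (hγ0 : 0 < γ) (hγ : γ ≤ 1 / 2) (hjm : j + 1 ≤ F.m) (hε : 0 < ε₀) (hε' : 0 < ε₂₉) (hB : 0 ≤ B₃) (hB' : 0 ≤ B₃') (ha₀ : 0 < a₀) (ha₁ : 0 < a₁)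
    (h15 : VariationalThm1RegSepCoP7MG F N (fun ν _ _ K k _ => c ≤ ν.M₁ ∧ k + c₀ ≤ F.m + K) B₃ a₀ a₁) (hc : c ≤ F.L ^ j) (hc₀ : c₀ ≤ F.m)
    (h15G : VariationalThm1GaugeRegSepCoP7MG F N (F.L ^ j) (fun ν _ _ K k _ => c ≤ ν.M₁ ∧ k + c₀ ≤ F.m + K) B₃ B₃' a₀ a₁)
    (hcomp : ∀ (p : B12.RunParams) (n : ℕ), n ≤ p.K → Step.InInterval (theta13OfThm1CCMW F N j γ ε₀ ε₂₉ B₃ B₃' a₀ a₁).γ n (gOfRecord₁₃ F N (theta13OfThm1CCMW F N j γ ε₀ ε₂₉ B₃ B₃' a₀ a₁) p) → ∀ m, m < n →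
      (theta13OfThm1CCMW F N j γ ε₀ ε₂₉ B₃ B₃' a₀ a₁).s2.cR * epsOfRecord (theta13OfThm1CCMW F N j γ ε₀ ε₂₉ B₃ B₃' a₀ a₁).ν (gOfRecord₁₃ F N (theta13OfThm1CCMW F N j γ ε₀ ε₂₉ B₃ B₃' a₀ a₁) p) m ≤ 2 * ((theta13OfThm1CCMW F N j γ ε₀ ε₂₉ B₃ B₃' a₀ a₁).s2.cR * epsOfRecord (theta13OfThm1CCMW F N j γ ε₀ ε₂₉ B₃ B₃' a₀ a₁).ν (gOfRecord₁₃ F N (theta13OfThm1CCMW F N j γ ε₀ ε₂₉ B₃ B₃' a₀ a₁) p) (m + 1)))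
    (hcompRev : ∀ (p : B12.RunParams) (n : ℕ), n ≤ p.K → Step.InInterval (theta13OfThm1CCMW F N j γ ε₀ ε₂₉ B₃ B₃' a₀ a₁).γ n (gOfRecord₁₃ F N (theta13OfThm1CCMW F N j γ ε₀ ε₂₉ B₃ B₃' a₀ a₁) p) → ∀ m, m < n →
      (theta13OfThm1CCMW F N j γ ε₀ ε₂₉ B₃ B₃' a₀ a₁).s2.cR * epsOfRecord (theta13OfThm1CCMW F N j γ ε₀ ε₂₉ B₃ B₃' a₀ a₁).ν (gOfRecord₁₃ F N (theta13OfThm1CCMW F N j γ ε₀ ε₂₉ B₃ B₃' a₀ a₁) p) (m + 1) ≤ 2 * ((theta13OfThm1CCMW F N j γ ε₀ ε₂₉ B₃ B₃' a₀ a₁).s2.cR * epsOfRecord (theta13OfThm1CCMW F N j γ ε₀ ε₂₉ B₃ B₃' a₀ a₁).ν (gOfRecord₁₃ F N (theta13OfThm1CCMW F N j γ ε₀ ε₂₉ B₃ B₃' a₀ a₁) p) m)) :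
    ∀ (p : B12.RunParams) (n : ℕ), n ≤ p.K → Step.InInterval (theta13OfThm1CCMW F N j γ ε₀ ε₂₉ B₃ B₃' a₀ a₁).γ n (gOfRecord₁₃ F N (theta13OfThm1CCMW F N j γ ε₀ ε₂₉ B₃ B₃' a₀ a₁) p) →
      BgProvisoΛ F N p.K (settingOfRecord₁₃ F N (theta13OfThm1CCMW F N j γ ε₀ ε₂₉ B₃ B₃' a₀ a₁) p) ((theta13OfThm1CCMW F N j γ ε₀ ε₂₉ B₃ B₃' a₀ a₁).Rz p.K) (theta13OfThm1CCMW F N j γ ε₀ ε₂₉ B₃ B₃' a₀ a₁).τ9.M n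
        (suppOfRecord₁₃SepCoP F N (theta13OfThm1CCMW F N j γ ε₀ ε₂₉ B₃ B₃' a₀ a₁) p n) (UbgOfRecord₁₃CoP F N (theta13OfThm1CCMW F N j γ ε₀ ε₂₉ B₃ B₃' a₀ a₁) p n) :=
  bgProvisoΛ_theta13OfThm1CCMW_of_thm1GaugeG_of_hadm_of_hcomp_of_hjm hγ0 hγ hjm hε hε' hB hB' ha₀ ha₁ h15 h15G
    (fun p n hn _ _ => ⟨by rw [theta13OfThm1CCMW_M₁]; exact hc, by omega⟩) hcomp hcompRev

/-- **§6c ★★★ THE SAME KEYED ON THE K0 SIDE's LOCATED BINDER `c₀ ≤ j + 1`** (k0-s1-w3 g7, INBOX l.37256: the level letter's twin of the floor letter `c ≤ L^j` in the 3ᴬ′-G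
text): on a non-wrapping family `c₀ ≤ j + 1 ≤ F.m`, so §6b applies (`hc₀.trans hjm`).  CONDITIONAL; nothing of Bałaban asserted.
[cite: Balaban1988Convergent, (2.28) p.259, Thm 1 p.262; Balaban1985Variational, Thm 1 (8)–(9) p.279, p.304 lines 1–2; Balaban1987RG1, (0.1) p.251] -/
theorem bgProvisoΛ_theta13OfThm1CCMW_of_thm1GaugeLevelFloorG_of_le_succ_of_hcomp_of_hjm (hγ0 : 0 < γ) (hγ : γ ≤ 1 / 2) (hjm : j + 1 ≤ F.m) (hε : 0 < ε₀) (hε' : 0 < ε₂₉) (hB : 0 ≤ B₃) (hB' : 0 ≤ B₃') (ha₀ : 0 < a₀) (ha₁ : 0 < a₁)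
    (h15 : VariationalThm1RegSepCoP7MG F N (fun ν _ _ K k _ => c ≤ ν.M₁ ∧ k + c₀ ≤ F.m + K) B₃ a₀ a₁) (hc : c ≤ F.L ^ j) (hc₀ : c₀ ≤ j + 1)
    (h15G : VariationalThm1GaugeRegSepCoP7MG F N (F.L ^ j) (fun ν _ _ K k _ => c ≤ ν.M₁ ∧ k + c₀ ≤ F.m + K) B₃ B₃' a₀ a₁)
    (hcomp : ∀ (p : B12.RunParams) (n : ℕ), n ≤ p.K → Step.InInterval (theta13OfThm1CCMW F N j γ ε₀ ε₂₉ B₃ B₃' a₀ a₁).γ n (gOfRecord₁₃ F N (theta13OfThm1CCMW F N j γ ε₀ ε₂₉ B₃ B₃' a₀ a₁) p) → ∀ m, m < n →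
      (theta13OfThm1CCMW F N j γ ε₀ ε₂₉ B₃ B₃' a₀ a₁).s2.cR * epsOfRecord (theta13OfThm1CCMW F N j γ ε₀ ε₂₉ B₃ B₃' a₀ a₁).ν (gOfRecord₁₃ F N (theta13OfThm1CCMW F N j γ ε₀ ε₂₉ B₃ B₃' a₀ a₁) p) m ≤ 2 * ((theta13OfThm1CCMW F N j γ ε₀ ε₂₉ B₃ B₃' a₀ a₁).s2.cR * epsOfRecord (theta13OfThm1CCMW F N j γ ε₀ ε₂₉ B₃ B₃' a₀ a₁).ν (gOfRecord₁₃ F N (theta13OfThm1CCMW F N j γ ε₀ ε₂₉ B₃ B₃' a₀ a₁) p) (m + 1)))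
    (hcompRev : ∀ (p : B12.RunParams) (n : ℕ), n ≤ p.K → Step.InInterval (theta13OfThm1CCMW F N j γ ε₀ ε₂₉ B₃ B₃' a₀ a₁).γ n (gOfRecord₁₃ F N (theta13OfThm1CCMW F N j γ ε₀ ε₂₉ B₃ B₃' a₀ a₁) p) → ∀ m, m < n →
      (theta13OfThm1CCMW F N j γ ε₀ ε₂₉ B₃ B₃' a₀ a₁).s2.cR * epsOfRecord (theta13OfThm1CCMW F N j γ ε₀ ε₂₉ B₃ B₃' a₀ a₁).ν (gOfRecord₁₃ F N (theta13OfThm1CCMW F N j γ ε₀ ε₂₉ B₃ B₃' a₀ a₁) p) (m + 1) ≤ 2 * ((theta13OfThm1CCMW F N j γ ε₀ ε₂₉ B₃ B₃' a₀ a₁).s2.cR * epsOfRecord (theta13OfThm1CCMW F N j γ ε₀ ε₂₉ B₃ B₃' a₀ a₁).ν (gOfRecord₁₃ F N (theta13OfThm1CCMW F N j γ ε₀ ε₂₉ B₃ B₃' a₀ a₁) p) m)) :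
    ∀ (p : B12.RunParams) (n : ℕ), n ≤ p.K → Step.InInterval (theta13OfThm1CCMW F N j γ ε₀ ε₂₉ B₃ B₃' a₀ a₁).γ n (gOfRecord₁₃ F N (theta13OfThm1CCMW F N j γ ε₀ ε₂₉ B₃ B₃' a₀ a₁) p) →
      BgProvisoΛ F N p.K (settingOfRecord₁₃ F N (theta13OfThm1CCMW F N j γ ε₀ ε₂₉ B₃ B₃' a₀ a₁) p) ((theta13OfThm1CCMW F N j γ ε₀ ε₂₉ B₃ B₃' a₀ a₁).Rz p.K) (theta13OfThm1CCMW F N j γ ε₀ ε₂₉ B₃ B₃' a₀ a₁).τ9.M n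
        (suppOfRecord₁₃SepCoP F N (theta13OfThm1CCMW F N j γ ε₀ ε₂₉ B₃ B₃' a₀ a₁) p n) (UbgOfRecord₁₃CoP F N (theta13OfThm1CCMW F N j γ ε₀ ε₂₉ B₃ B₃' a₀ a₁) p n) :=
  bgProvisoΛ_theta13OfThm1CCMW_of_thm1GaugeLevelFloorG_of_hcomp_of_hjm hγ0 hγ hjm hε hε' hB hB' ha₀ ha₁ h15 hc (hc₀.trans hjm) h15G hcomp hcompRev

end PlanGuard

end Summit.QuantumFields.YangMills.Theorems.BalabanUVNodesN11BgRowGaugeGOfHcubeOmega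

end
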